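import Mathlib
import HarnessLib
import Summits.ResolutionOfSingularities.ResolutionOfSingularities.Theorems.WildQuotientsWildQuotientResolutionS1aLinearRecoord
import Summits.ResolutionOfSingularities.ResolutionOfSingularities.Theorems.WildQuotientsWildQuotientResolutionS1aTriangularKillsIn

/-!
# S1a — INSTANCE CLASS I-6: EVERY LINEAR `ℤ/p`-ACTION IS KILLED BY ONE MOVE (`KillsIn 1 (initial)`), any number of variables, every prime `p`

[OURS · L1 W4.5c · lead-1 g14; plan-1 RULING R-F15h «I-6 := `linear_killsIn_one` + `exists_reachLowerF_initial_of_linear`: every datum whose σ is k-LINEAR on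
V = span(X 0 … X (m−1)) satisfies `KillsIn 1 (initial)` … DELIVERABLE = the FIRST CLASS-LEVEL inhabitation of `S1.ReachLowerInFX p`: all faithful linear ℤ/p-actions
on 𝔸⁴ (every p) — say «one-shot class», never «linear case of the crux settled» (the door D1 is still by name)»] — NOT statements of the manuscript; counted 0;
AI-level work, weaker than expert review. Crux stmt-ResolutionOfSingularities-17941 `CyclicQuotientFourfolds`, line `s1a-logminvertex` v13 (`stub_reachLowerInFX`).

THE LINEAR DATUM: action data `(X′, X₁, q, ρ, g₀)` with `X′` AFFINE regular, `g₀ ^ p = 1`, `char k = p`, and `e : Γ(X′, ⊤) ≃ k[x_ι]` (`ι` finite) intertwining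
`g₀` with a ring automorphism `σ` fixing constants that is LINEAR on the variables (`σ xᵢ ∈ span_k(x_j)`, equivalently `σ xᵢ = Σⱼ Mᵢⱼ xⱼ`) and moves some
variable. PROOF = `exists_linearTriangularisation` (`…S1aLinearRecoord`: adapted basis of the image flag of `M − 1`, read as new variables `X_s`, recoordination
`α : k[X_s] ≃ k[x_ι]` absorbed into `e`, conjugate `σ' = α⁻¹σα` of chain type) + `triangular_killsIn_one` (`…S1aTriangularKillsIn`). The order `σ^[p] = id`
needed for the nilpotency of `M − 1` comes from the intertwiner and `g₀ ^ p = 1` (`actOEquiv_iterate_eq_self`).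
* ★★★ `linear_killsIn_one_of_matrix` / ★★★ `linear_killsIn_one` — `KillsIn 1 (GModel.initial hq h₀)` for every linear datum (matrix form / span form);
* ★★★ `exists_reachLowerF_initial_of_linear` — the conclusion of `ReachLowerInF(X)` for every linear datum and every root decoration.
THE ONE-SHOT CLASS SO FAR (its BOUNDARY among the census germs, R-F15h (a)): linear actions (this file; on 𝔸⁴ the Jordan types `J₄`, `J₃⊕J₁`, `J₂⊕J₂`,
`J₂⊕1⊕1`) and the triangular chain-type germs of `…S1aTriangularKillsIn` (sm). For the other census germs NO choice of centre variables and weights at the root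
satisfies (T1)–(T3) [hand check, OURS]: (T2) confines the centre variables to the radical of the augmentation ideal `I_σ`, and then — trA (`x₁ ↦ x₁+x₀²,
x₂ ↦ x₂+x₀³, x₃ ↦ x₃+x₂`; `I_σ = (x₀², x₂)`): with `x₀` in the centre (T3) fails at `x₀` (`h·x₀ ∉ I_σ + 𝒥_{w+1}`: `x₀` is not an increment to leading order),
without it (T1) fails for `x₁` (`x₀² ∉ 𝒥₁ = (x₂)`); k2a / a1c2 (`I_σ = (x₀, x₁²)` resp. `(x₀, x₁² + …)`): (T3) fails at `x₁`, and without `x₁` (T1) fails for `x₃`;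
a1 / D₄ (`I_σ = (x₀, x₁x₂)` resp. `(x₀, x₁x₂(x₁−x₂))`): (T2) forces the centre `{x₀}` and then (T1) fails for `x₃`. These need ≥ 2 moves (X-CERT: trA 2,
k2a 2, a1c2 2, a1 3, D₄ 4) — the two-shot family starts with trA (I-5d).
-/

set_option linter.dupNamespace false

noncomputable section

open CategoryTheory Limits AlgebraicGeometry TopologicalSpace Topology Opposite MvPolynomial
open Literature.AlgebraicGeometry.Resolution Literature.AlgebraicGeometry.RelativeSpec
open Summit.ResolutionOfSingularities.ResolutionOfSingularities.Theorems.WildQuotientResolution.S1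
open Summit.ResolutionOfSingularities.ResolutionOfSingularities.Theorems.WildQuotientResolution.S1.NodeAtlas
open Summit.ResolutionOfSingularities.ResolutionOfSingularities.Theorems.WildQuotientResolution.S1.KillCert
open Summit.ResolutionOfSingularities.ResolutionOfSingularities.Theorems.WildQuotientResolution.S1.GoodCharts
open Summit.ResolutionOfSingularities.ResolutionOfSingularities.Theorems.WildQuotientResolution.S1.NpFrame
open Summit.ResolutionOfSingularities.ResolutionOfSingularities.Theorems.WildQuotientResolution.S1.LinearKill

namespace Summit.ResolutionOfSingularities.ResolutionOfSingularities.Theorems.WildQuotientResolution.S1.GameFrame.GModel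

variable {p : ℕ} {X' X₁ : Scheme.{0}} {q : X' ⟶ X₁} {G : Type} [Group G] {ρ : G →* Aut X'} {g₀ : G}

/-- **The intertwined automorphism has order dividing `p`**: if `e` intertwines the action of `g₀` (with `g₀ ^ p = 1`) on `Γ(X′, ⊤)` with `σ`, then `σ^[p] = id`.
[OURS · L1 W4.5c] -/
theorem iterate_eq_self_of_intertwine (hq : ∀ g : G, (ρ g).hom ≫ q = q) [IsAffine X'] [IsAffineHom q] (hg₀ : g₀ ^ p = 1)
    {R : Type} [CommRing R] (σ : R ≃+* R) (e : Γ(X', ⊤) ≃+* R)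
    (hστ : ∀ t : Γ(X', ⊤), e ((ρ g₀⁻¹).hom.appLE ⊤ ⊤ (by rw [Scheme.Hom.preimage_top]) t) = σ (e t)) (y : R) : (⇑σ)^[p] y = y := by
  haveI : IsAffine (⊤ : X'.Opens) := isAffineOpen_top X'
  have hAff : IsAffineHom ((⊤ : X'.Opens).ι ≫ q) := inferInstance
  have hst : ∀ g : G, (ρ g).hom ⁻¹ᵁ (⊤ : X'.Opens) = ⊤ := fun g => Scheme.Hom.preimage_top _
  let O : (⟨ρ, hq⟩ : ActionOver q G).StableAffineOpens := ⟨⊤, hst, hAff⟩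
  let τ : Γ(X', (⊤ : X'.Opens)) ≃+* Γ(X', (⊤ : X'.Opens)) := actOEquiv (⟨ρ, hq⟩ : ActionOver q G) O g₀
  have hact : ∀ t, e (τ t) = σ (e t) := fun t => hστ t
  have hiter : ∀ (n : ℕ) (t : Γ(X', ⊤)), (⇑σ)^[n] (e t) = e ((⇑τ)^[n] t) := by
    intro n
    induction n with
    | zero => intro t; rfl
    | succ n ih => intro t; rw [Function.iterate_succ_apply, Function.iterate_succ_apply, ← hact, ih]
  have h1 := hiter p (e.symm y)
  rw [e.apply_symm_apply, actOEquiv_iterate_eq_self (⟨ρ, hq⟩ : ActionOver q G) O hg₀] at h1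
  rw [h1, e.apply_symm_apply]

/-- ★★★ **INSTANCE CLASS I-6 (matrix form): EVERY LINEAR ACTION IS KILLED BY ONE MOVE OF THE GAME.** Let `(X′, X₁, q, ρ, g₀)` be action data with `X′` AFFINE,
regular, locally Noetherian and separated, `X₁` separated, `q` finite and `G`-invariant, `G` finite, `g₀ ^ p = 1`, `X₁ → Spec k′` locally of finite type, and let
`e : Γ(X′, ⊤) ≃+* k[x_ι]` (`ι` finite, `char k = p`) intertwine the action of `g₀` with a ring automorphism `σ` fixing constants which is LINEAR with matrix `M`
(`σ xᵢ = Σⱼ Mᵢⱼ xⱼ`) and moves some variable. Then `KillsIn 1 (GModel.initial hq h₀)`: ONE admissible move — the depth-weighted blow-up of the image flag of `M − 1`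
(`exists_linearTriangularisation`), `X′` itself a principal-centre chart — all of whose realisations carry a node atlas with EMPTY formal locus.
[OURS · L1 W4.5c · R-F15h I-6; one-shot class, NOT «the linear case of the crux» (the door is by name); NOT a statement of the manuscript] -/
theorem linear_killsIn_one_of_matrix [Finite G] (hp : p.Prime) (hG : ∀ g : G, g ∈ Subgroup.zpowers g₀) (hg₀ : g₀ ^ p = 1)
    (hq : ∀ g : G, (ρ g).hom ≫ q = q) [IsIntegral X'] [IsLocallyNoetherian X'] [X'.IsSeparated] [IsAffine X'] [X₁.IsSeparated] [IsFinite q]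
    (hreg : Scheme.IsRegular X') {k' : Type} [Field k'] (φ : X₁ ⟶ Spec (.of k')) [LocallyOfFiniteType φ]
    {k : Type} [Field k] [CharP k p] {ι : Type} [Fintype ι] [DecidableEq ι]
    (σ : MvPolynomial ι k ≃+* MvPolynomial ι k) (hC : ∀ a : k, σ (C a) = C a)
    (M : Matrix ι ι k) (hM : ∀ i, σ (X i) = ∑ j, M i j • X j) (hne : ∃ i, σ (X i) ≠ X i)
    (e : Γ(X', ⊤) ≃+* MvPolynomial ι k)
    (hστ : ∀ t : Γ(X', ⊤), e ((ρ g₀⁻¹).hom.appLE ⊤ ⊤ (by rw [Scheme.Hom.preimage_top]) t) = σ (e t))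
    (h₀ : NodeAtlas p (⟨ρ, hq⟩ : ActionOver q G) g₀) :
    KillsIn 1 (GModel.initial (p := p) (g₀ := g₀) hq h₀) := by
  classical
  haveI : Fact p.Prime := ⟨hp⟩
  have hσp : ∀ y, (⇑σ)^[p] y = y := iterate_eq_self_of_intertwine hq hg₀ σ e hστ
  obtain ⟨s, _, α, σ', c, v, w, -, hασ, hC', hc, hv, hw, hT1, hT1c, hT2, hT3⟩ :=
    exists_linearTriangularisation σ hC M hM hσp hne
  -- the new presentation `e' = α⁻¹ ∘ e` intertwines `g₀` with `σ'`
  let e' : Γ(X', ⊤) ≃+* MvPolynomial s k := e.trans α.symm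
  have hστ' : ∀ t : Γ(X', ⊤), e' ((ρ g₀⁻¹).hom.appLE ⊤ ⊤ (by rw [Scheme.Hom.preimage_top]) t) = σ' (e' t) := by
    intro t
    change α.symm (e _) = σ' (α.symm (e t))
    rw [hστ]
    apply α.injective
    rw [α.apply_symm_apply, hασ, α.apply_symm_apply]
  refine triangular_killsIn_one hp hG hg₀ hq hreg φ σ' hC' hc v hv w hw hT1 hT1c ⟨1, by rw [pow_one]; exact hT2⟩ (fun l => ?_) e' hστ' h₀
  obtain ⟨u, hu, hσu⟩ := hT3 l
  exact ⟨u, 1, isUnit_one, hu, by rw [hσu, one_mul, sub_self]; exact Ideal.zero_mem _⟩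

/-- ★★★ **INSTANCE CLASS I-6: EVERY LINEAR ACTION IS KILLED BY ONE MOVE OF THE GAME** (span form: `σ xᵢ ∈ span_k {xⱼ}` for all `i`, `σ xᵢ ≠ xᵢ` for some `i`;
`char k = p`, any finite set of variables, every prime `p`). [OURS · L1 W4.5c · R-F15h I-6; one-shot class; NOT a statement of the manuscript] -/
theorem linear_killsIn_one [Finite G] (hp : p.Prime) (hG : ∀ g : G, g ∈ Subgroup.zpowers g₀) (hg₀ : g₀ ^ p = 1)
    (hq : ∀ g : G, (ρ g).hom ≫ q = q) [IsIntegral X'] [IsLocallyNoetherian X'] [X'.IsSeparated] [IsAffine X'] [X₁.IsSeparated] [IsFinite q]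
    (hreg : Scheme.IsRegular X') {k' : Type} [Field k'] (φ : X₁ ⟶ Spec (.of k')) [LocallyOfFiniteType φ]
    {k : Type} [Field k] [CharP k p] {ι : Type} [Fintype ι] [DecidableEq ι]
    (σ : MvPolynomial ι k ≃+* MvPolynomial ι k) (hC : ∀ a : k, σ (C a) = C a)
    (hlin : ∀ i, σ (X i) ∈ Submodule.span k (Set.range (X : ι → MvPolynomial ι k))) (hne : ∃ i, σ (X i) ≠ X i)
    (e : Γ(X', ⊤) ≃+* MvPolynomial ι k)
    (hστ : ∀ t : Γ(X', ⊤), e ((ρ g₀⁻¹).hom.appLE ⊤ ⊤ (by rw [Scheme.Hom.preimage_top]) t) = σ (e t))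
    (h₀ : NodeAtlas p (⟨ρ, hq⟩ : ActionOver q G) g₀) :
    KillsIn 1 (GModel.initial (p := p) (g₀ := g₀) hq h₀) := by
  have hrow : ∀ i, ∃ c : ι → k, ∑ j, c j • (X j : MvPolynomial ι k) = σ (X i) := fun i =>
    (Submodule.mem_span_range_iff_exists_fun k).mp (hlin i)
  choose M hM using hrow
  exact linear_killsIn_one_of_matrix hp hG hg₀ hq hreg φ σ hC (Matrix.of M) (fun i => (hM i).symm) hne e hστ h₀

/-- ★★★ **INSTANCE CLASS I-6 OF RECORD: every LINEAR datum satisfies the conclusion of `ReachLowerInF(X)`** at its initial model with ANY root decoration `𝔄₀`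
(`exists_reachLowerF_of_killsIn_datum` on `linear_killsIn_one`) — the first CLASS-LEVEL inhabitation of the research statement `S1.ReachLowerInFX p` (all faithful
linear `ℤ/p`-actions on `𝔸ⁿ_k`, every `p`); a one-shot class, NOT «the linear case of the crux» (the door D1 stays by name).
[OURS · L1 W4.5c · R-F15h I-6; NOT a statement of the manuscript] -/
theorem exists_reachLowerF_initial_of_linear [Finite G] (hp : p.Prime) (hG : ∀ g : G, g ∈ Subgroup.zpowers g₀) (hg₀ : g₀ ^ p = 1)
    (hq : ∀ g : G, (ρ g).hom ≫ q = q) [IsIntegral X'] [IsLocallyNoetherian X'] [X'.IsSeparated] [IsAffine X'] [X₁.IsSeparated] [IsFinite q]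
    (hreg : Scheme.IsRegular X') {k' : Type} [Field k'] (φ : X₁ ⟶ Spec (.of k')) [LocallyOfFiniteType φ]
    {k : Type} [Field k] [CharP k p] {ι : Type} [Fintype ι] [DecidableEq ι]
    (σ : MvPolynomial ι k ≃+* MvPolynomial ι k) (hC : ∀ a : k, σ (C a) = C a)
    (hlin : ∀ i, σ (X i) ∈ Submodule.span k (Set.range (X : ι → MvPolynomial ι k))) (hne : ∃ i, σ (X i) ≠ X i)
    (e : Γ(X', ⊤) ≃+* MvPolynomial ι k)
    (hστ : ∀ t : Γ(X', ⊤), e ((ρ g₀⁻¹).hom.appLE ⊤ ⊤ (by rw [Scheme.Hom.preimage_top]) t) = σ (e t))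
    (h₀ : NodeAtlas p (⟨ρ, hq⟩ : ActionOver q G) g₀) (𝔄₀ : NodeAtlasData p (GModel.initial hq h₀).act g₀) :
    ∃ P : ∀ M : GModel p q G ρ g₀, NodeAtlasData p M.act g₀ → Prop,
      P (GModel.initial hq h₀) 𝔄₀ ∧ ∀ (M : GModel p q G ρ g₀) (𝔄 : NodeAtlasData p M.act g₀), P M 𝔄 → ¬ M.Terminal →
        ∃ n : ℕ, TreeF P (fun N 𝔅 => LexLTF N 𝔅 M 𝔄) n M 𝔄 :=
  exists_reachLowerF_of_killsIn_datum hp hG φ (GModel.initial hq h₀) 𝔄₀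
    (linear_killsIn_one hp hG hg₀ hq hreg φ σ hC hlin hne e hστ h₀)

/-- **I-6, literal form**: the conclusion of `ReachLowerInF p` for a linear datum with the stub's root decoration `NodeAtlasData.ofNodeAtlas h₀`. [OURS · L1 W4.5c · R-F15h] -/
theorem exists_reachLowerF_initial_ofNodeAtlas_of_linear [Finite G] (hp : p.Prime) (hG : ∀ g : G, g ∈ Subgroup.zpowers g₀) (hg₀ : g₀ ^ p = 1)
    (hq : ∀ g : G, (ρ g).hom ≫ q = q) [IsIntegral X'] [IsLocallyNoetherian X'] [X'.IsSeparated] [IsAffine X'] [X₁.IsSeparated] [IsFinite q]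
    (hreg : Scheme.IsRegular X') {k' : Type} [Field k'] (φ : X₁ ⟶ Spec (.of k')) [LocallyOfFiniteType φ]
    {k : Type} [Field k] [CharP k p] {ι : Type} [Fintype ι] [DecidableEq ι]
    (σ : MvPolynomial ι k ≃+* MvPolynomial ι k) (hC : ∀ a : k, σ (C a) = C a)
    (hlin : ∀ i, σ (X i) ∈ Submodule.span k (Set.range (X : ι → MvPolynomial ι k))) (hne : ∃ i, σ (X i) ≠ X i)
    (e : Γ(X', ⊤) ≃+* MvPolynomial ι k)
    (hστ : ∀ t : Γ(X', ⊤), e ((ρ g₀⁻¹).hom.appLE ⊤ ⊤ (by rw [Scheme.Hom.preimage_top]) t) = σ (e t))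
    (h₀ : NodeAtlas p (⟨ρ, hq⟩ : ActionOver q G) g₀) :
    ∃ P : ∀ M : GModel p q G ρ g₀, NodeAtlasData p M.act g₀ → Prop,
      P (GModel.initial hq h₀) (NodeAtlasData.ofNodeAtlas (p := p) (ρ := (⟨ρ, hq⟩ : ActionOver q G)) (g₀ := g₀) h₀) ∧
      ∀ (M : GModel p q G ρ g₀) (𝔄 : NodeAtlasData p M.act g₀), P M 𝔄 → ¬ M.Terminal →
        ∃ n : ℕ, TreeF P (fun N 𝔅 => LexLTF N 𝔅 M 𝔄) n M 𝔄 :=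
  exists_reachLowerF_initial_of_linear hp hG hg₀ hq hreg φ σ hC hlin hne e hστ h₀ _

end Summit.ResolutionOfSingularities.ResolutionOfSingularities.Theorems.WildQuotientResolution.S1.GameFrame.GModel

end
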